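import Literature.Analysis.FluidPDE.TransportHolderEstimate
import Literature.Analysis.FluidPDE.OnsagerBDSVSchauderHigher
import Literature.Analysis.FunctionSpaces.TorusInverseLaplacianCalculus
import Literature.Analysis.FunctionSpaces.TorusEnstrophyOrthogonality
import Literature.Analysis.FunctionSpaces.HolderInterpolation
import Mathlib.Analysis.Complex.ExponentialBounds
import HarnessLib

/-!
# The BDSV gluing stage: higher-order Hölder estimates for transport equations

Buckmaster–De Lellis–Székelyhidi–Vicol, *Onsager's conjecture for admissible weak solutions*,
CPAM 72 (2019) = arXiv:1701.08678, control the `C^{N,α}` norms of transported quantities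
(§3.1, proof of Prop. 3.1; §3.2, proof of Prop. 3.3; App. B (B.3)) by differentiating the
transport equation, "commuting the derivative `∂^θ` with the material derivative", estimating
the commutator by the product rule, applying the `C^α` transport estimate (B.2) and absorbing
(Grönwall) under the CFL-type condition `|t - t₀| ‖v‖_{1+α} ≲ 1`. This file proves that scheme
once and for all, one partial derivative at a time, for jointly smooth fields on `[a,b] × T^d`:

* `BDSV.exists_forall_eContDiffHolderNorm_le_of_Icc`: the `C^{N,α}` norms of the
  slices of a jointly smooth field are bounded on `[a,b]` (so suprema can be absorbed);
* `BDSV.transport_partialDeriv`: if `∂ₜF + (v·∇)F = G` then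
  `∂ₜ(∂ₖF) + (v·∇)(∂ₖF) = ∂ₖG - (∂ₖv·∇)F`;
* `BDSV.eContDiffHolderNorm_transport_higher`: **level-`N` transport estimate**: for every `N`
  there is `A = A(N, d) ≥ 1` (`A(0) = 6`, `A(N+1) = 8(d+1)3^N A(N)`) such that, if `‖Dv‖ ≤ K` with `K(b-a) ≤ 1/2`, `‖v(s)‖_{j,α} ≤ V_j`
  (`1 ≤ j ≤ N`) with `(b - a) V_1 A ≤ 1`, `‖F(s)‖_{m,α} ≤ Φ_m` for `1 ≤ m < N`,
  `‖F(t₀)‖_{N,α} ≤ F₀` and `‖G(s)‖_{N,α} ≤ G₀` on `[a,b]`, then for all `s ∈ [a,b]`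
  `‖F(s)‖_{N,α} ≤ A (F₀ + (b-a) G₀ + (b-a) ∑_{j=1}^{N-1} V_{j+1} Φ_{N-j})`.

## References

* T. Buckmaster, C. De Lellis, L. Székelyhidi Jr., V. Vicol, *Onsager's conjecture for admissible
  weak solutions*, Comm. Pure Appl. Math. 72 (2019) 229–274 = arXiv:1701.08678: §3.1 (proof of
  Prop. 3.1), §3.2 (proof of Prop. 3.3), App. B Prop. B.1.
-/

noncomputable section

open MeasureTheory Set Filter Function
open scoped NNReal ENNReal ContDiff Topology

set_option maxSynthPendingDepth 3

namespace Literature.Analysis.FluidPDE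

namespace BDSV

open FunctionSpaces FunctionSpaces.Torus

variable {d : Type} [Fintype d] [DecidableEq d] {F : Type} [NormedAddCommGroup F] [NormedSpace ℝ F]

/-! ## Finiteness of the `C^{N,α}` norms of jointly smooth fields -/

omit [DecidableEq d] in
/-- The `C^{0,α}` norm of a `C¹` function on the torus from pointwise bounds:
`‖g‖_{0,α} ≤ 3M₀ + M₁` if `‖g‖ ≤ M₀` and `‖Dg‖ ≤ M₁` (`α ≤ 1`; interpolation at unit scale).
[folklore] -/
theorem eContDiffHolderNorm_zero_le_of_bounds {g : UnitAddTorus d → F} (hg : IsSmooth g)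
    {M₀ M₁ : ℝ} (h0 : 0 ≤ M₀) (h1 : 0 ≤ M₁) (hM₀ : ∀ x, ‖g x‖ ≤ M₀)
    (hM₁ : ∀ x, ‖Torus.fderiv g x‖ ≤ M₁) {α : ℝ≥0} (hα : α ≤ 1) :
    Torus.eContDiffHolderNorm 0 α g ≤ ENNReal.ofReal (3 * M₀ + M₁) := by
  have hM : ∀ i ≤ 0 + 1, ∀ y, ‖iteratedFDeriv ℝ i (lift g) y‖ ≤ (fun i => if i = 0 then M₀ else M₁) i := by
    intro i hi y
    rcases Nat.le_one_iff_eq_zero_or_eq_one.1 hi with rfl | rfl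
    · simpa using hM₀ (proj y)
    · simp only [one_ne_zero, if_false]
      rw [← norm_iteratedFDeriv_fderiv, norm_iteratedFDeriv_zero, fderiv_lift]
      exact hM₁ _
  have h := eContDiffHolderNorm_le_of_norm_iteratedFDeriv_le (k := 0) (hg.isContDiff (by simp))
    (M := fun i => if i = 0 then M₀ else M₁) (fun i => by split_ifs <;> assumption) hM hα one_pos
  refine h.trans (le_of_eq ?_)
  congr 1
  simp
  ring

/-- **The `C^{N,α}` norms of the slices of a jointly smooth field on `[a,b] × T^d` are bounded**
(`a < b`, `α ≤ 1`; induction on `N` through `‖g‖_{N+1,α} ≤ ‖g‖_∞ + ∑ₖ ‖∂ₖg‖_{N,α}`, the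
partial derivatives being jointly smooth). [folklore] -/
theorem exists_forall_eContDiffHolderNorm_le_of_Icc {a b : ℝ} (hab : a < b)
    (N : ℕ) {α : ℝ≥0} (hα : α ≤ 1) :
    ∀ {u : ℝ → UnitAddTorus d → F}, IsSmoothSpaceTimeOn (Icc a b) u →
      ∃ B : ℝ, 0 ≤ B ∧ ∀ s ∈ Icc a b, Torus.eContDiffHolderNorm N α (u s) ≤ ENNReal.ofReal B := by
  induction N with
  | zero =>
    intro u hu
    obtain ⟨M₀, hM₀⟩ := hu.exists_norm_le_of_isCompact isCompact_Icc subset_rfl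
    have hD : ∀ k, IsSmoothSpaceTimeOn (Icc a b) (fun t => partialDeriv k (u t)) := fun k =>
      hu.partialDeriv (uniqueDiffOn_Icc hab) k
    choose M hM using fun k => (hD k).exists_norm_le_of_isCompact isCompact_Icc subset_rfl
    have ha : a ∈ Icc a b := left_mem_Icc.2 hab.le
    have hM₀0 : 0 ≤ M₀ := (norm_nonneg _).trans (hM₀ a ha 0)
    have hM0 : ∀ k, 0 ≤ M k := fun k => (norm_nonneg _).trans (hM k a ha 0)
    refine ⟨3 * M₀ + ∑ k, M k, add_nonneg (by positivity) (Finset.sum_nonneg fun k _ => hM0 k),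
      fun s hs => ?_⟩
    have hus : IsSmooth (u s) := hu.isSmooth_slice hs
    refine eContDiffHolderNorm_zero_le_of_bounds hus hM₀0 (Finset.sum_nonneg fun k _ => hM0 k)
      (hM₀ s hs) (fun x => ?_) hα
    refine ContinuousLinearMap.opNorm_le_bound _ (Finset.sum_nonneg fun k _ => hM0 k) fun h => ?_
    rw [fderiv_apply_eq_sum_partialDeriv (hus.isContDiff (by simp)), Finset.sum_mul]
    refine (norm_sum_le _ _).trans (Finset.sum_le_sum fun k _ => ?_)
    rw [norm_smul, mul_comm]
    exact mul_le_mul (hM k s hs x) (PiLp.norm_apply_le h k) (norm_nonneg _) (hM0 k)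
  | succ N IH =>
    intro u hu
    obtain ⟨M₀, hM₀⟩ := hu.exists_norm_le_of_isCompact isCompact_Icc subset_rfl
    have hD : ∀ k, IsSmoothSpaceTimeOn (Icc a b) (fun t => partialDeriv k (u t)) := fun k =>
      hu.partialDeriv (uniqueDiffOn_Icc hab) k
    choose B hB0 hB using fun k => IH (hD k)
    have ha : a ∈ Icc a b := left_mem_Icc.2 hab.le
    have hM₀0 : 0 ≤ M₀ := (norm_nonneg _).trans (hM₀ a ha 0)
    refine ⟨M₀ + ∑ k, B k, add_nonneg hM₀0 (Finset.sum_nonneg fun k _ => hB0 k), fun s hs => ?_⟩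
    have hus : IsSmooth (u s) := hu.isSmooth_slice hs
    calc Torus.eContDiffHolderNorm (N + 1) α (u s)
        ≤ eSupNorm (u s) + Torus.eContDiffHolderNorm N α (Torus.fderiv (u s)) := by
          rw [Torus.eContDiffHolderNorm_succ_eq_fderiv]
      _ ≤ ENNReal.ofReal M₀ + ∑ k, ENNReal.ofReal (B k) := by
          refine add_le_add (eSupNorm_le_ofReal (hM₀ s hs)) ?_
          exact (eContDiffHolderNorm_fderiv_le_sum hus N α).trans
            (Finset.sum_le_sum fun k _ => hB k s hs)
      _ = ENNReal.ofReal (M₀ + ∑ k, B k) := by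
          rw [ENNReal.ofReal_add hM₀0 (Finset.sum_nonneg fun k _ => hB0 k),
            ENNReal.ofReal_sum_of_nonneg fun k _ => hB0 k]

/-! ## Differentiating the transport equation -/

omit [DecidableEq d] in
/-- Smooth functions on the torus are `C¹`. [folklore] -/
theorem isContDiff_one_of_isSmooth {G : Type} [NormedAddCommGroup G] [NormedSpace ℝ G]
    {g : UnitAddTorus d → G} (hg : IsSmooth g) : IsContDiff 1 g :=
  hg.isContDiff (by simp)

/-- **Leibniz rule for the convective derivative**: `∂ₖ((u·∇)w) = (∂ₖu·∇)w + (u·∇)(∂ₖw)` for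
smooth `u, w` (Schwarz for `∂ₖ∂ⱼw`). [folklore] -/
theorem partialDeriv_convect {u : UnitAddTorus d → EuclideanSpace ℝ d} {w : UnitAddTorus d → F}
    (hu : IsSmooth u) (hw : IsSmooth w) (k : d) (x : UnitAddTorus d) :
    partialDeriv k (convect u w) x =
      convect (partialDeriv k u) w x + convect u (partialDeriv k w) x := by
  have h1 : convect u w = fun y => ∑ j, u y j • partialDeriv j w y := by
    funext y
    exact fderiv_apply_eq_sum_partialDeriv (isContDiff_one_of_isSmooth hw) y (u y)
  have hterm : ∀ j, IsContDiff 1 (fun y => u y j • partialDeriv j w y) := fun j =>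
    ((hu.apply j).smul' (hw.partialDeriv j)).isContDiff (by simp)
  rw [h1, partialDeriv_finset_sum Finset.univ (fun j _ => hterm j),
    convect, convect, fderiv_apply_eq_sum_partialDeriv (isContDiff_one_of_isSmooth hw),
    fderiv_apply_eq_sum_partialDeriv (isContDiff_one_of_isSmooth (hw.partialDeriv k)),
    ← Finset.sum_add_distrib]
  refine Finset.sum_congr rfl fun j _ => ?_
  rw [partialDeriv_smul (isContDiff_one_of_isSmooth (hu.apply j))
      (isContDiff_one_of_isSmooth (hw.partialDeriv j)),
    partialDeriv_apply_coord (isContDiff_one_of_isSmooth hu), add_comm]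
  congr 1
  rw [partialDeriv_comm hw k j x]

/-- **Differentiating the transport equation** (BDSV §3.2: "commuting the derivative `∂^θ`
with the material derivative"): if `∂ₜF + (v·∇)F = G` on `[a,b] × T^d`, `a < b`, for jointly
smooth `v, F`, then `∂ₜ(∂ₖF) + (v·∇)(∂ₖF) = ∂ₖG - (∂ₖv·∇)F`. [cite: BuckmasterEtAl2018, §3.2 (proof of Prop. 3.3)] -/
theorem transport_partialDeriv {a b : ℝ} (hab : a < b) {v : ℝ → UnitAddTorus d → EuclideanSpace ℝ d}
    {Fl G : ℝ → UnitAddTorus d → F} (hv : IsSmoothSpaceTimeOn (Icc a b) v)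
    (hF : IsSmoothSpaceTimeOn (Icc a b) Fl)
    (heq : ∀ s ∈ Icc a b, ∀ x, timeDerivWithin (Icc a b) Fl s x + convect (v s) (Fl s) x = G s x)
    (k : d) {s : ℝ} (hs : s ∈ Icc a b) (x : UnitAddTorus d) :
    timeDerivWithin (Icc a b) (fun t => partialDeriv k (Fl t)) s x +
        convect (v s) (partialDeriv k (Fl s)) x =
      partialDeriv k (G s) x - convect (partialDeriv k (v s)) (Fl s) x := by
  have hvs : IsSmooth (v s) := hv.isSmooth_slice hs
  have hFs : IsSmooth (Fl s) := hF.isSmooth_slice hs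
  have hTs : IsSmooth (timeDerivWithin (Icc a b) Fl s) :=
    hF.isSmooth_timeDerivWithin (uniqueDiffOn_Icc hab) hs
  have hGs : G s = timeDerivWithin (Icc a b) Fl s + convect (v s) (Fl s) := by
    funext y
    exact (heq s hs y).symm
  rw [timeDerivWithin_partialDeriv_comm hab hF hs k x, hGs,
    partialDeriv_add (isContDiff_one_of_isSmooth hTs) (isContDiff_one_of_isSmooth (hvs.convect hFs)),
    Pi.add_apply, partialDeriv_convect hvs hFs k x]
  abel

/-! ## The level-`N` transport estimate -/
set_option maxHeartbeats 400000 in -- buildfix (bf3-g26): 160k/180k FAIL, 200k PASS at accept time; line-neutral budget line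
/-- **The level-`N` transport estimate** (BDSV §3.1–3.2, App. B: differentiate the transport
equation, estimate the commutator `(∂ₖv·∇)F` by the Leibniz rule, apply the `C^α` estimate (B.2)
and absorb under the CFL-type smallness `(b-a)‖v‖_{1+α} ≲ 1`). For jointly smooth `v, F, G` on
`[a,b] × T^d` with `∂ₜF + (v·∇)F = G`, `‖Dv‖ ≤ K`, `K(b-a) ≤ 1/2`, `‖v(s)‖_{j,α} ≤ V_j`
(`1 ≤ j ≤ N`), `(b-a) V_1 A ≤ 1` (`A = A(N,d)`, the constant provided), `‖F(s)‖_{m,α} ≤ Φ_m`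
(`1 ≤ m < N`), `‖F(t₀)‖_{N,α} ≤ F₀`, `‖G(s)‖_{N,α} ≤ G₀`: for all `s ∈ [a,b]`,
`‖F(s)‖_{N,α} ≤ A (F₀ + (b-a) G₀ + (b-a) ∑_{i < N-1} V_{i+2} Φ_{N-1-i})`.
[cite: BuckmasterEtAl2018, §3.2 (proof of Prop. 3.3) and App. B Prop. B.1] -/
theorem eContDiffHolderNorm_transport_higher (N : ℕ) :
    ∃ A : ℝ, 1 ≤ A ∧ ∀ {a b : ℝ} (_ : a < b) {α : ℝ≥0} (_ : α ≤ 1)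
      {v : ℝ → UnitAddTorus d → EuclideanSpace ℝ d} (_ : IsSmoothSpaceTimeOn (Icc a b) v)
      {K : ℝ≥0} (_ : ∀ s ∈ Icc a b, ∀ x, ‖Torus.fderiv (v s) x‖ ≤ K)
      (_ : (K : ℝ) * (b - a) ≤ 1 / 2) {V : ℕ → ℝ} (_ : ∀ j, 0 ≤ V j) {t₀ : ℝ} (_ : t₀ ∈ Icc a b),
      (∀ s ∈ Icc a b, ∀ j, 1 ≤ j → j ≤ N →
        Torus.eContDiffHolderNorm j α (v s) ≤ ENNReal.ofReal (V j)) →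
      (b - a) * V 1 * A ≤ 1 →
      ∀ {Fl G : ℝ → UnitAddTorus d → F}, IsSmoothSpaceTimeOn (Icc a b) Fl →
        IsSmoothSpaceTimeOn (Icc a b) G →
        (∀ s ∈ Icc a b, ∀ x, timeDerivWithin (Icc a b) Fl s x + convect (v s) (Fl s) x = G s x) →
        ∀ {Φ : ℕ → ℝ}, (∀ m, 0 ≤ Φ m) →
          (∀ s ∈ Icc a b, ∀ m, 1 ≤ m → m < N →
            Torus.eContDiffHolderNorm m α (Fl s) ≤ ENNReal.ofReal (Φ m)) →
          ∀ {F₀ G₀ : ℝ}, 0 ≤ F₀ → 0 ≤ G₀ →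
            Torus.eContDiffHolderNorm N α (Fl t₀) ≤ ENNReal.ofReal F₀ →
            (∀ s ∈ Icc a b, Torus.eContDiffHolderNorm N α (G s) ≤ ENNReal.ofReal G₀) →
            ∀ s ∈ Icc a b, Torus.eContDiffHolderNorm N α (Fl s) ≤
              ENNReal.ofReal (A *
                (F₀ + (b - a) * G₀ +
                  (b - a) * ∑ i ∈ Finset.range (N - 1), V (i + 2) * Φ (N - 1 - i))) := by
  induction N with
  | zero =>
    refine ⟨6, by norm_num, ?_⟩
    intro a b hab α hα v hv K hK hKL V hV0 t₀ ht₀ _ _ Fl G hF _ heq Φ _ _ F₀ G₀ hF₀0 hG₀0 hF₀ hGb s hs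
    have hL : 0 < b - a := sub_pos.2 hab
    set L := b - a with hLdef
    have h := Torus.eContDiffHolderNorm_transport_le hab hv hF heq hK ht₀ hs hF₀0 hG₀0 hF₀
      (fun s' hs' => hGb s' (uIcc_subset_Icc ht₀ hs hs'))
    refine h.trans (ENNReal.ofReal_le_ofReal ?_)
    have hst : |s - t₀| ≤ L := by
      rw [abs_sub_le_iff]
      constructor <;> linarith [hs.1, hs.2, ht₀.1, ht₀.2]
    have hexp : Real.exp (α * K * |s - t₀|) ≤ 3 := by
      have h1 : (α : ℝ) * K * |s - t₀| ≤ 1 := by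
        have hαle : (α : ℝ) ≤ 1 := by exact_mod_cast hα
        have hα0 : (0 : ℝ) ≤ α := α.2
        have hK0 : (0 : ℝ) ≤ K := K.2
        have h2 : (K : ℝ) * |s - t₀| ≤ K * L := mul_le_mul_of_nonneg_left hst hK0
        have h3 : (α : ℝ) * (K * |s - t₀|) ≤ 1 * (K * L) :=
          mul_le_mul hαle h2 (mul_nonneg hK0 (abs_nonneg _)) zero_le_one
        calc (α : ℝ) * K * |s - t₀| = α * (K * |s - t₀|) := by ring
          _ ≤ 1 * (K * L) := h3
          _ ≤ 1 := by linarith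
      calc Real.exp (α * K * |s - t₀|) ≤ Real.exp 1 := Real.exp_le_exp.2 h1
        _ ≤ 3 := Real.exp_one_lt_three.le
    simp only [Nat.zero_sub, Finset.range_zero, Finset.sum_empty, mul_zero, add_zero]
    have h2 : F₀ + 2 * |s - t₀| * G₀ ≤ 2 * (F₀ + L * G₀) := by nlinarith
    calc Real.exp (α * K * |s - t₀|) * (F₀ + 2 * |s - t₀| * G₀) ≤ 3 * (2 * (F₀ + L * G₀)) :=
          mul_le_mul hexp h2 (by positivity) (by norm_num)
      _ = 6 * (F₀ + L * G₀) := by ring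
  | succ N IH =>
    obtain ⟨A, hA1, hIH⟩ := IH
    have hA0 : 0 ≤ A := zero_le_one.trans hA1
    have hbig : ∀ D : ℕ, 1 ≤ 8 * ((D : ℝ) + 1) * 3 ^ N := fun D => by
      have h3 : (1 : ℝ) ≤ 3 ^ N := one_le_pow₀ (by norm_num)
      have hD : (0 : ℝ) ≤ D := Nat.cast_nonneg D
      nlinarith
    refine ⟨8 * ((Fintype.card d : ℝ) + 1) * 3 ^ N * A, ?_, ?_⟩
    · calc (1 : ℝ) ≤ A := hA1
        _ ≤ 8 * ((Fintype.card d : ℝ) + 1) * 3 ^ N * A := le_mul_of_one_le_left hA0 (hbig _)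
    intro a b hab α hα v hv K hK hKL V hV0 t₀ ht₀ hV hsmall Fl G hF hG heq Φ hΦ0 hΦ F₀ G₀ hF₀0 hG₀0 hF₀ hGb
    have hL : 0 < b - a := sub_pos.2 hab
    set L := b - a with hLdef
    set D := Fintype.card d with hDdef
    have hU : UniqueDiffOn ℝ (Icc a b) := uniqueDiffOn_Icc hab
    set A' : ℝ := 8 * ((D : ℝ) + 1) * 3 ^ N * A with hA'def
    have hAA' : A ≤ A' := le_mul_of_one_le_left hA0 (hbig D)
    -- smallness at level `N`
    have hsmallN : L * V 1 * A ≤ 1 :=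
      le_trans (mul_le_mul_of_nonneg_left hAA' (mul_nonneg hL.le (hV0 1))) hsmall
    -- finiteness of the level-`N+1` norms and their supremum `M`
    obtain ⟨Bfin, hBfin0, hBfin⟩ := exists_forall_eContDiffHolderNorm_le_of_Icc hab (N + 1) hα hF
    set S := ⨆ s ∈ Icc a b, Torus.eContDiffHolderNorm (N + 1) α (Fl s) with hSdef
    have hSle : S ≤ ENNReal.ofReal Bfin := iSup₂_le fun s hs => hBfin s hs
    have hST : S ≠ ⊤ := ne_top_of_le_ne_top ENNReal.ofReal_ne_top hSle
    set M := S.toReal with hMdef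
    have hM0 : 0 ≤ M := ENNReal.toReal_nonneg
    have hFM : ∀ s ∈ Icc a b, Torus.eContDiffHolderNorm (N + 1) α (Fl s) ≤ ENNReal.ofReal M := by
      intro s hs
      rw [hMdef, ENNReal.ofReal_toReal hST]
      exact le_iSup₂ (f := fun s _ => Torus.eContDiffHolderNorm (N + 1) α (Fl s)) s hs
    -- the lower-order sum at level `N+1`
    set Sig : ℝ := ∑ i ∈ Finset.range N, V (i + 2) * Φ (N - i) with hSigdef
    have hSig0 : 0 ≤ Sig := Finset.sum_nonneg fun i _ => mul_nonneg (hV0 _) (hΦ0 _)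
    -- the forcing bound for the differentiated equations
    set G₁ : ℝ := G₀ + 3 ^ N * (V 1 * M + Sig) with hG₁def
    have hVM : 0 ≤ V 1 * M + Sig := add_nonneg (mul_nonneg (hV0 1) hM0) hSig0
    have hG₁0 : 0 ≤ G₁ := add_nonneg hG₀0 (mul_nonneg (by positivity) hVM)
    -- the differentiated equation for each `k`
    have hstep : ∀ k, ∀ s ∈ Icc a b, Torus.eContDiffHolderNorm N α (partialDeriv k (Fl s)) ≤
        ENNReal.ofReal (A * (F₀ + L * G₁ + L * Sig)) := by
      intro k
      set Fk : ℝ → UnitAddTorus d → F := fun t => partialDeriv k (Fl t) with hFkdef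
      set Gk : ℝ → UnitAddTorus d → F := fun t x =>
        partialDeriv k (G t) x - convect (partialDeriv k (v t)) (Fl t) x with hGkdef
      have hFk : IsSmoothSpaceTimeOn (Icc a b) Fk := hF.partialDeriv hU k
      have hGk : IsSmoothSpaceTimeOn (Icc a b) Gk :=
        (hG.partialDeriv hU k).sub ((hv.partialDeriv hU k).convect hF hU)
      have heqk : ∀ s ∈ Icc a b, ∀ x,
          timeDerivWithin (Icc a b) Fk s x + convect (v s) (Fk s) x = Gk s x :=
        fun s hs x => transport_partialDeriv hab hv hF heq k hs x
      -- hypotheses of the induction hypothesis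
      have hVN : ∀ s ∈ Icc a b, ∀ j, 1 ≤ j → j ≤ N →
          Torus.eContDiffHolderNorm j α (v s) ≤ ENNReal.ofReal (V j) :=
        fun s hs j hj hjN => hV s hs j hj (hjN.trans (Nat.le_succ N))
      have hΦk : ∀ s ∈ Icc a b, ∀ m, 1 ≤ m → m < N →
          Torus.eContDiffHolderNorm m α (Fk s) ≤ ENNReal.ofReal (Φ (m + 1)) := by
        intro s hs m hm hmN
        have hFs : IsSmooth (Fl s) := hF.isSmooth_slice hs
        exact (Torus.eContDiffHolderNorm_partialDeriv_le
          (hFs.isContDiff (by exact_mod_cast le_top)) k α).trans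
          (hΦ s hs (m + 1) (Nat.le_add_left 1 m) (Nat.succ_lt_succ hmN))
      have hF₀k : Torus.eContDiffHolderNorm N α (Fk t₀) ≤ ENNReal.ofReal F₀ :=
        (Torus.eContDiffHolderNorm_partialDeriv_le
          ((hF.isSmooth_slice ht₀).isContDiff (by exact_mod_cast le_top)) k α).trans hF₀
      have hGk' : ∀ s ∈ Icc a b, Torus.eContDiffHolderNorm N α (Gk s) ≤ ENNReal.ofReal G₁ := by
        intro s hs
        have hvs : IsSmooth (v s) := hv.isSmooth_slice hs
        have hFs : IsSmooth (Fl s) := hF.isSmooth_slice hs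
        have hGs : IsSmooth (G s) := hG.isSmooth_slice hs
        have h1 : Torus.eContDiffHolderNorm N α (partialDeriv k (G s)) ≤ ENNReal.ofReal G₀ :=
          (Torus.eContDiffHolderNorm_partialDeriv_le
            (hGs.isContDiff (by exact_mod_cast le_top)) k α).trans (hGb s hs)
        -- the commutator term
        have h2 : Torus.eContDiffHolderNorm N α (convect (partialDeriv k (v s)) (Fl s)) ≤
            ENNReal.ofReal (3 ^ N * (V 1 * M + Sig)) := by
          have hc := Torus.eContDiffHolderNorm_convect_le (u := partialDeriv k (v s)) (v := Fl s)
            ((hvs.partialDeriv k).isContDiff (by exact_mod_cast le_top))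
            (hFs.isContDiff (by exact_mod_cast le_top)) α (k := N)
          refine hc.trans ?_
          -- bound each term of the Leibniz sum
          have hu : ∀ j, j ≤ N → Torus.eContDiffHolderNorm j α (partialDeriv k (v s)) ≤
              ENNReal.ofReal (V (j + 1)) := fun j hj =>
            (Torus.eContDiffHolderNorm_partialDeriv_le
              (hvs.isContDiff (by exact_mod_cast le_top)) k α).trans
              (hV s hs (j + 1) (Nat.le_add_left 1 j) (Nat.succ_le_succ hj))
          have hterm0 : Torus.eContDiffHolderNorm 0 α (partialDeriv k (v s)) *
              Torus.eContDiffHolderNorm (N - 0 + 1) α (Fl s) ≤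
              ENNReal.ofReal (V 1) * ENNReal.ofReal M :=
            mul_le_mul' (hu 0 (Nat.zero_le N)) (by rw [Nat.sub_zero]; exact hFM s hs)
          have htermi : ∀ i ∈ Finset.range N,
              Torus.eContDiffHolderNorm (i + 1) α (partialDeriv k (v s)) *
                Torus.eContDiffHolderNorm (N - (i + 1) + 1) α (Fl s) ≤
              ENNReal.ofReal (V (i + 2)) * ENNReal.ofReal (Φ (N - i)) := by
            intro i hi
            have hiN : i < N := Finset.mem_range.1 hi
            have heq' : N - (i + 1) + 1 = N - i := by omega
            refine mul_le_mul' (hu (i + 1) hiN) ?_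
            rw [heq']
            exact hΦ s hs (N - i) (by omega) (by omega)
          calc 3 ^ N * ∑ j ∈ Finset.range (N + 1), Torus.eContDiffHolderNorm j α (partialDeriv k (v s)) *
                  Torus.eContDiffHolderNorm (N - j + 1) α (Fl s)
              = 3 ^ N * ((∑ i ∈ Finset.range N,
                  Torus.eContDiffHolderNorm (i + 1) α (partialDeriv k (v s)) *
                    Torus.eContDiffHolderNorm (N - (i + 1) + 1) α (Fl s)) +
                  Torus.eContDiffHolderNorm 0 α (partialDeriv k (v s)) *
                    Torus.eContDiffHolderNorm (N - 0 + 1) α (Fl s)) := by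
                rw [Finset.sum_range_succ']
            _ ≤ 3 ^ N * ((∑ i ∈ Finset.range N, ENNReal.ofReal (V (i + 2)) * ENNReal.ofReal (Φ (N - i))) +
                  ENNReal.ofReal (V 1) * ENNReal.ofReal M) :=
                mul_le_mul' le_rfl (add_le_add (Finset.sum_le_sum htermi) hterm0)
            _ = ENNReal.ofReal (3 ^ N * (V 1 * M + Sig)) := by
                rw [hSigdef, ENNReal.ofReal_mul (by positivity), ENNReal.ofReal_pow (by norm_num),
                  ENNReal.ofReal_ofNat, ENNReal.ofReal_add (mul_nonneg (hV0 1) hM0) hSig0,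
                  ENNReal.ofReal_mul (hV0 1), ENNReal.ofReal_sum_of_nonneg
                    (fun i _ => mul_nonneg (hV0 _) (hΦ0 _)), add_comm]
                congr 2
                exact Finset.sum_congr rfl fun i _ => (ENNReal.ofReal_mul (hV0 _)).symm
        have hsub : IsContDiff N (partialDeriv k (G s)) :=
          (hGs.partialDeriv k).isContDiff (by exact_mod_cast le_top)
        have hconv : IsContDiff N (convect (partialDeriv k (v s)) (Fl s)) :=
          ((hvs.partialDeriv k).convect hFs).isContDiff (by exact_mod_cast le_top)
        have hGk_eq : Gk s = partialDeriv k (G s) - convect (partialDeriv k (v s)) (Fl s) := rfl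
        rw [hGk_eq]
        refine (Torus.eContDiffHolderNorm_sub_le hsub hconv).trans ?_
        rw [hG₁def, ENNReal.ofReal_add hG₀0 (mul_nonneg (by positivity) hVM)]
        exact add_le_add h1 h2
      -- apply the induction hypothesis
      have hIH' := hIH hab hα hv hK hKL hV0 ht₀ hVN hsmallN hFk hGk heqk (Φ := fun m => Φ (m + 1))
        (fun m => hΦ0 _) hΦk hF₀0 hG₁0 hF₀k hGk'
      intro s hs
      refine (hIH' s hs).trans (ENNReal.ofReal_le_ofReal ?_)
      refine mul_le_mul_of_nonneg_left (add_le_add le_rfl (mul_le_mul_of_nonneg_left ?_ hL.le)) hA0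
      -- the lower-order sum at level `N` is part of the one at level `N+1`
      rw [hSigdef]
      have hsub : Finset.range (N - 1) ⊆ Finset.range N := Finset.range_mono (Nat.sub_le N 1)
      refine le_trans (le_of_eq ?_) (Finset.sum_le_sum_of_subset_of_nonneg hsub
        fun i _ _ => mul_nonneg (hV0 _) (hΦ0 _))
      refine Finset.sum_congr rfl fun i hi => ?_
      have hi' : i < N - 1 := Finset.mem_range.1 hi
      congr 2
      omega
    -- assemble: the level-`N+1` norm through the sup norm and the partial derivatives
    have hsupF : ∀ s ∈ Icc a b, eSupNorm (Fl s) ≤ ENNReal.ofReal (F₀ + L * G₀) := by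
      intro s hs
      have h := Torus.eSupNorm_transport_le hab hv hF heq hK ht₀ hs
      refine h.trans ?_
      have h1 : eSupNorm (Fl t₀) ≤ ENNReal.ofReal F₀ :=
        (Torus.eSupNorm_le_eContDiffHolderNorm (N + 1) α _).trans hF₀
      have h2 : (⨆ s' ∈ uIcc t₀ s, eSupNorm (G s')) ≤ ENNReal.ofReal G₀ :=
        iSup₂_le fun s' hs' => (Torus.eSupNorm_le_eContDiffHolderNorm (N + 1) α _).trans
          (hGb s' (uIcc_subset_Icc ht₀ hs hs'))
      have hst : |s - t₀| ≤ L := by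
        rw [abs_sub_le_iff]
        constructor <;> linarith [hs.1, hs.2, ht₀.1, ht₀.2]
      calc eSupNorm (Fl t₀) + ENNReal.ofReal |s - t₀| * ⨆ s' ∈ uIcc t₀ s, eSupNorm (G s')
          ≤ ENNReal.ofReal F₀ + ENNReal.ofReal L * ENNReal.ofReal G₀ :=
            add_le_add h1 (mul_le_mul' (ENNReal.ofReal_le_ofReal hst) h2)
        _ = ENNReal.ofReal (F₀ + L * G₀) := by
            rw [← ENNReal.ofReal_mul hL.le, ENNReal.ofReal_add hF₀0 (by positivity)]
    set X : ℝ := F₀ + L * G₀ + D * (A * (F₀ + L * G₁ + L * Sig)) with hXdef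
    have hD0 : (0 : ℝ) ≤ D := Nat.cast_nonneg D
    have hX1 : 0 ≤ F₀ + L * G₀ := add_nonneg hF₀0 (mul_nonneg hL.le hG₀0)
    have hin : 0 ≤ F₀ + L * G₁ + L * Sig :=
      add_nonneg (add_nonneg hF₀0 (mul_nonneg hL.le hG₁0)) (mul_nonneg hL.le hSig0)
    have hX2 : 0 ≤ (D : ℝ) * (A * (F₀ + L * G₁ + L * Sig)) := mul_nonneg hD0 (mul_nonneg hA0 hin)
    have hX0 : 0 ≤ X := add_nonneg hX1 hX2
    have hFX : ∀ s ∈ Icc a b, Torus.eContDiffHolderNorm (N + 1) α (Fl s) ≤ ENNReal.ofReal X := by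
      intro s hs
      have hFs : IsSmooth (Fl s) := hF.isSmooth_slice hs
      calc Torus.eContDiffHolderNorm (N + 1) α (Fl s)
          ≤ eSupNorm (Fl s) + ∑ k, Torus.eContDiffHolderNorm N α (partialDeriv k (Fl s)) :=
            eContDiffHolderNorm_succ_le_sum hFs N α
        _ ≤ ENNReal.ofReal (F₀ + L * G₀) +
              ∑ _k : d, ENNReal.ofReal (A * (F₀ + L * G₁ + L * Sig)) :=
            add_le_add (hsupF s hs) (Finset.sum_le_sum fun k _ => hstep k s hs)
        _ = ENNReal.ofReal X := by
            rw [Finset.sum_const, Finset.card_univ, ← hDdef, nsmul_eq_mul, ← ENNReal.ofReal_natCast D,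
              ← ENNReal.ofReal_mul (Nat.cast_nonneg D), hXdef]
            exact (ENNReal.ofReal_add hX1 hX2).symm
    -- absorb: `M ≤ X = X' + θ M` with `θ ≤ 1/8`
    have hMX : M ≤ X := by
      have h : S ≤ ENNReal.ofReal X := iSup₂_le fun s hs => hFX s hs
      have h' : ENNReal.ofReal M = S := by rw [hMdef, ENNReal.ofReal_toReal hST]
      rw [← h'] at h
      exact (ENNReal.ofReal_le_ofReal_iff hX0).1 h
    set X' : ℝ := F₀ + L * G₀ + D * (A * (F₀ + L * (G₀ + 3 ^ N * Sig) + L * Sig)) with hX'def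
    have hθ : D * A * L * 3 ^ N * V 1 ≤ 1 / 8 := by
      have h1 : (D : ℝ) * A * 3 ^ N ≤ A' / 8 := by
        rw [hA'def]
        have : (D : ℝ) ≤ D + 1 := by linarith
        have h3 : (0 : ℝ) ≤ 3 ^ N := by positivity
        nlinarith [mul_nonneg (mul_nonneg (Nat.cast_nonneg D) hA0) h3]
      calc (D : ℝ) * A * L * 3 ^ N * V 1 = (D * A * 3 ^ N) * (L * V 1) := by ring
        _ ≤ A' / 8 * (L * V 1) :=
            mul_le_mul_of_nonneg_right h1 (mul_nonneg hL.le (hV0 1))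
        _ = (L * V 1 * A') / 8 := by ring
        _ ≤ 1 / 8 := by linarith
    have hXsplit : X = X' + (D * A * L * 3 ^ N * V 1) * M := by
      rw [hXdef, hX'def, hG₁def]
      ring
    have hM2 : M ≤ 2 * X' := by
      have h1 : M ≤ X' + (1 / 8) * M := by
        calc M ≤ X := hMX
          _ = X' + (D * A * L * 3 ^ N * V 1) * M := hXsplit
          _ ≤ X' + (1 / 8) * M := by
              refine add_le_add le_rfl (mul_le_mul_of_nonneg_right hθ hM0)
      have hX'0 : 0 ≤ X' := by positivity
      linarith
    -- conclude
    intro s hs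
    refine (hFM s hs).trans (ENNReal.ofReal_le_ofReal (hM2.trans ?_))
    rw [show N + 1 - 1 = N from rfl, hA'def]
    -- `2 X' ≤ A_{N+1} (F₀ + L G₀ + L Sig)`
    have h3N : (1 : ℝ) ≤ 3 ^ N := one_le_pow₀ (by norm_num)
    have hDA : 0 ≤ (D : ℝ) * A := mul_nonneg hD0 hA0
    have hP1 : 0 ≤ (3 ^ N - 1) * (((D : ℝ) + 1) * A) :=
      mul_nonneg (sub_nonneg.2 h3N) (mul_nonneg (by linarith) hA0)
    have hcoef1 : 2 * (1 + D * A) ≤ 8 * (D + 1) * 3 ^ N * A := by nlinarith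
    have hcoef2 : 2 * (D * A * (3 ^ N + 1)) ≤ 8 * (D + 1) * 3 ^ N * A := by
      have hP2 : 0 ≤ (3 ^ N - 1) * ((D : ℝ) * A) := mul_nonneg (sub_nonneg.2 h3N) hDA
      have hP3 : 0 ≤ (3 : ℝ) ^ N * A := mul_nonneg (zero_le_one.trans h3N) hA0
      nlinarith
    have hX'eq : 2 * X' = 2 * (1 + D * A) * F₀ + 2 * (1 + D * A) * (L * G₀) +
        2 * (D * A * (3 ^ N + 1)) * (L * Sig) := by
      rw [hX'def]
      ring
    rw [hX'eq]
    have hLG : 0 ≤ L * G₀ := by positivity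
    have hLS : 0 ≤ L * Sig := by positivity
    calc 2 * (1 + D * A) * F₀ + 2 * (1 + D * A) * (L * G₀) + 2 * (D * A * (3 ^ N + 1)) * (L * Sig)
        ≤ 8 * (D + 1) * 3 ^ N * A * F₀ + 8 * (D + 1) * 3 ^ N * A * (L * G₀) +
            8 * (D + 1) * 3 ^ N * A * (L * Sig) := by
          refine add_le_add (add_le_add ?_ ?_) ?_
          · exact mul_le_mul_of_nonneg_right hcoef1 hF₀0
          · exact mul_le_mul_of_nonneg_right hcoef1 hLG
          · exact mul_le_mul_of_nonneg_right hcoef2 hLS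
      _ = 8 * (D + 1) * 3 ^ N * A * (F₀ + L * G₀ + L * Sig) := by ring

/-! ## Restriction to subintervals and the continuity (bootstrap) argument -/

omit [DecidableEq d] in
/-- The one-sided time derivative within a nondegenerate subinterval agrees with the one within
the larger interval (both are limits of the same difference quotients). [folklore] -/
theorem timeDerivWithin_Icc_of_subset {a b a' b' : ℝ} (hab' : a' < b') (hsub : Icc a' b' ⊆ Icc a b)
    {u : ℝ → UnitAddTorus d → F} (hu : IsSmoothSpaceTimeOn (Icc a b) u) {t : ℝ}
    (ht : t ∈ Icc a' b') (x : UnitAddTorus d) :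
    timeDerivWithin (Icc a' b') u t x = timeDerivWithin (Icc a b) u t x :=
  ((hu.hasDerivWithinAt_slice (hsub ht) x).mono hsub).derivWithin (uniqueDiffOn_Icc hab' t ht)

omit [DecidableEq d] in
/-- A transport equation on `[a,b] × T^d` restricts to every nondegenerate subinterval. [folklore] -/
theorem transport_restrict {a b a' b' : ℝ} (hab' : a' < b') (hsub : Icc a' b' ⊆ Icc a b)
    {v : ℝ → UnitAddTorus d → EuclideanSpace ℝ d} {Fl G : ℝ → UnitAddTorus d → F}
    (hF : IsSmoothSpaceTimeOn (Icc a b) Fl)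
    (heq : ∀ s ∈ Icc a b, ∀ x, timeDerivWithin (Icc a b) Fl s x + convect (v s) (Fl s) x = G s x) :
    ∀ s ∈ Icc a' b', ∀ x, timeDerivWithin (Icc a' b') Fl s x + convect (v s) (Fl s) x = G s x :=
  fun s hs x => by rw [timeDerivWithin_Icc_of_subset hab' hsub hF hs x]; exact heq s (hsub hs) x

/-- **The continuity argument, discretised.** Let `μ : ℝ → ℝ≥0∞` on `J = [a,b] ∋ t₀` with
`μ t₀ ≤ B`. If (improvement) on every subinterval `[a',b'] ⊆ J` containing `t₀` the bound
`μ ≤ 2B` implies `μ ≤ B`, and (propagation, uniform step `ε > 0`) `μ s₀ ≤ B` at `s₀ ∈ J` implies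
`μ ≤ 2B` on `J ∩ [s₀ - ε, s₀ + ε]`, then `μ ≤ B` on `J` (induction on the number of steps of
length `ε` from `t₀`; no continuity of `μ` is needed). [folklore] -/
theorem bootstrap_Icc {a b t₀ : ℝ} (ht₀ : t₀ ∈ Icc a b) {μ : ℝ → ℝ≥0∞} {B : ℝ≥0∞} {ε : ℝ}
    (hε : 0 < ε) (h0 : μ t₀ ≤ B)
    (himp : ∀ a' b', Icc a' b' ⊆ Icc a b → t₀ ∈ Icc a' b' →
      (∀ s ∈ Icc a' b', μ s ≤ 2 * B) → ∀ s ∈ Icc a' b', μ s ≤ B)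
    (hprop : ∀ s₀ ∈ Icc a b, μ s₀ ≤ B → ∀ s ∈ Icc a b, |s - s₀| ≤ ε → μ s ≤ 2 * B) :
    ∀ t ∈ Icc a b, μ t ≤ B := by
  -- `P n`: the bound holds within distance `n ε` of `t₀`
  have hP : ∀ n : ℕ, ∀ s ∈ Icc a b, |s - t₀| ≤ n * ε → μ s ≤ B := by
    intro n
    induction n with
    | zero =>
      intro s hs hst
      have : s = t₀ := by
        have h : |s - t₀| ≤ 0 := by simpa using hst
        exact sub_eq_zero.1 (abs_nonpos_iff.1 h)
      rw [this]
      exact h0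
    | succ n IH =>
      intro s hs hst
      -- the interval `J ∩ [t₀ - (n+1)ε, t₀ + (n+1)ε]`
      set a' := max a (t₀ - (n + 1) * ε) with ha'
      set b' := min b (t₀ + (n + 1) * ε) with hb'
      have hsub : Icc a' b' ⊆ Icc a b := fun x hx =>
        ⟨(le_max_left _ _).trans hx.1, hx.2.trans (min_le_left _ _)⟩
      have hnε : 0 ≤ (n + 1 : ℝ) * ε := by positivity
      have ht₀' : t₀ ∈ Icc a' b' :=
        ⟨max_le ht₀.1 (by linarith), le_min ht₀.2 (by linarith)⟩
      have hmem : ∀ x ∈ Icc a' b', |x - t₀| ≤ (n + 1) * ε := fun x hx => by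
        rw [abs_sub_le_iff]
        constructor
        · linarith [hx.2, min_le_right b (t₀ + (n + 1) * ε)]
        · linarith [hx.1, le_max_right a (t₀ - (n + 1) * ε)]
      -- `μ ≤ 2B` on this interval
      have h2B : ∀ x ∈ Icc a' b', μ x ≤ 2 * B := by
        intro x hx
        have hxJ : x ∈ Icc a b := hsub hx
        by_cases hxn : |x - t₀| ≤ n * ε
        · exact (IH x hxJ hxn).trans (by
            calc B = 1 * B := (one_mul B).symm
              _ ≤ 2 * B := mul_le_mul' (by norm_num) le_rfl)
        · rw [not_le] at hxn
          -- the anchor at distance `n ε` from `t₀` on the side of `x`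
          have hn0 : 0 ≤ (n : ℝ) * ε := by positivity
          rcases le_or_gt t₀ x with htx | hxt
          · set s₀ := t₀ + n * ε with hs₀
            have hx0 : x - t₀ = |x - t₀| := (abs_of_nonneg (sub_nonneg.2 htx)).symm
            have hs₀x : s₀ ≤ x := by linarith
            have hs₀J : s₀ ∈ Icc a b := ⟨by linarith [ht₀.1], hs₀x.trans hxJ.2⟩
            have hμ₀ : μ s₀ ≤ B := IH s₀ hs₀J (by
              rw [hs₀, add_sub_cancel_left, abs_of_nonneg hn0])
            refine hprop s₀ hs₀J hμ₀ x hxJ ?_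
            rw [abs_of_nonneg (sub_nonneg.2 hs₀x)]
            have := hmem x hx
            rw [← hx0] at this
            rw [hs₀]
            linarith
          · set s₀ := t₀ - n * ε with hs₀
            have hx0 : t₀ - x = |x - t₀| := by
              rw [abs_sub_comm, abs_of_pos (sub_pos.2 hxt)]
            have hxs₀ : x ≤ s₀ := by linarith
            have hs₀J : s₀ ∈ Icc a b := ⟨hxJ.1.trans hxs₀, by linarith [ht₀.2]⟩
            have hμ₀ : μ s₀ ≤ B := IH s₀ hs₀J (by
              rw [hs₀, sub_sub_cancel_left, abs_neg, abs_of_nonneg hn0])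
            refine hprop s₀ hs₀J hμ₀ x hxJ ?_
            rw [abs_sub_comm, abs_of_nonneg (sub_nonneg.2 hxs₀)]
            have := hmem x hx
            rw [← hx0] at this
            rw [hs₀]
            linarith
      -- improvement
      have hsI : s ∈ Icc a' b' := by
        rw [abs_sub_le_iff] at hst
        push_cast at hst
        exact ⟨max_le hs.1 (by linarith [hst.2]), le_min hs.2 (by linarith [hst.1])⟩
      exact himp a' b' hsub ht₀' h2B s hsI
  intro t ht
  obtain ⟨n, hn⟩ := exists_nat_ge (|t - t₀| / ε)
  exact hP n t ht (by rwa [div_le_iff₀ hε] at hn)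

end BDSV

end Literature.Analysis.FluidPDE
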